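import Summits.CriticalPhenomena.Ising3DConformalLimit.Theorems.PrecisionLaplacianDirectCorrelationStableTailConverseSpine
import HarnessLib.Audit

/-!
# Line `diffusive-branch-is-nonsaturation` — crux `PrecisionLaplacian.DirectCorrelationStableTail`
# (stmt-CriticalPhenomena-4799, route PrecisionLaplacian, rank 3) — FINAL SKELETON rev c4-2: ALL STUBS LANDED

Continuation lead prover-line-stmt-CriticalPhenomena-4799-c4-0 (2026-08-17).  The registered skeleton rev c4-1 (seven stubs
S0 `stub_exponentWindow` p131205, S1 `stub_tightness` p132101, S2 `stub_scaleIdentity` p132220, S3 `stub_kernelScaling` p135417,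
S4 `stub_rieszGaussian` p136825, S5 `stub_symbolIdentification` p137860, S6 `stub_levyContinuityTransfer` p138638) is entirely in the tree;
the composition is the tree theorem `DiffusiveBranchIsNonsaturation.DirectCorrelationStableTail_of`
(`Theorems/PrecisionLaplacianDirectCorrelationStableTailConverseSpine.lean` p138781, over `…ConverseSpineModulo.lean` p138132; Ising-free abstract
core `…ConverseTauberian.lean` p138324).

RESULT (the converse two-point spine).  Under the crux's hypothesis `H`:

    crux `DirectCorrelationStableTail`  ⟺  item 0634 `IsingEuclidUpgradeR2RotInvPowerLaw` ∧ item 1342 `NonSaturation`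
                                        ⟺  item 0634 with exponent `Δ > 1/2`,

and item 0634 alone DECIDES the crux (`Δ > 1/2 ⇒ crux`, `Δ = 1/2 ⇒ ¬crux`).  The crux is therefore closed MODULO THE NAMED ITEMS
1342 and 0634 (no open stub remains); it is not an independent open problem.  This file only re-exports the composition BY NAME
for the crux-chain record (namespace `…DiffusiveBranchIsNonsaturation.Final` to avoid clashing with the tree declarations).
-/

noncomputable section

namespace Summit.CriticalPhenomena.Ising3DConformalLimit.Cruxes.DirectCorrelationStableTail.DiffusiveBranchIsNonsaturation.Final

open Summit.CriticalPhenomena.Ising3DConformalLimit.Theses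

/-- **The line closes the crux modulo the named items 1342 and 0634** (all seven registered stubs landed): composition BY NAME. -/
theorem DirectCorrelationStableTail_of (hNS : PerfectScreening.NonSaturation)
    (hR2 : IsingEuclidUpgrade.IsingEuclidUpgradeR2RotInvPowerLaw) :
    Summit.CriticalPhenomena.Ising3DConformalLimit.Theses.PrecisionLaplacian.DirectCorrelationStableTail :=
  DiffusiveBranchIsNonsaturation.DirectCorrelationStableTail_of hNS hR2

/-- **Headline**: under `H`, crux ⟺ (0634 ∧ 1342). -/
theorem directCorrelationStableTail_iff
    (hH : ∀ A : Finset (Literature.Probability.LatticeModels.Site 3),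
      (Matrix.of fun (p q : ↥A) => Literature.Probability.LatticeModels.criticalTwoPoint 3 (q.1 - p.1)).PosDef ∧
      ∀ u v : ↥A, (u ≠ v → (Matrix.of fun (p q : ↥A) =>
        Literature.Probability.LatticeModels.criticalTwoPoint 3 (q.1 - p.1))⁻¹ u v ≤ 0) ∧
        0 ≤ ∑ w, (Matrix.of fun (p q : ↥A) => Literature.Probability.LatticeModels.criticalTwoPoint 3 (q.1 - p.1))⁻¹ u w) :
    PrecisionLaplacian.DirectCorrelationStableTail ↔
      (IsingEuclidUpgrade.IsingEuclidUpgradeR2RotInvPowerLaw ∧ PerfectScreening.NonSaturation) :=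
  DiffusiveBranchIsNonsaturation.directCorrelationStableTail_iff_twoPointLaw_and_nonSaturation_of_levyContinuity
    DiffusiveBranchIsNonsaturation.stub_levyContinuityTransfer hH

end Summit.CriticalPhenomena.Ising3DConformalLimit.Cruxes.DirectCorrelationStableTail.DiffusiveBranchIsNonsaturation.Final

end
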